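import Summits.QuantumAdvantage.QuantumAdvantage.Theorems.SosSandwichPseudoBoundedAAClassicalCornerL2OSSSNoGoPrep
import HarnessLib

/-!
# Crux `PseudoBoundedAA` (stmt-QuantumAdvantage-15237, route SosSandwich) — the `L²`-OSSS question on the classical
# corner: NO-GO for the per-tree (variance-normalised bilinear) route, part 2/2 — the ratio

Support file (`--supports stmt-QuantumAdvantage-15237`), sequel of `…ClassicalCornerSensitivityOSSS.lean`.

Context.  On the classical corner `R_T ⊆ K_T` of the crux PB-AA (acceptance probabilities `p = Σ_k w_k [t_k accepts]` of
randomized classical query algorithms) the census asks for the `L²`-OSSS law `16·Var[p]² ≤ C₀·Σⱼ δ̄ⱼ·Infⱼ[p]` with an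
ABSOLUTE constant `C₀` (it would give the exponent pair `(2,1)` on `R_T`).  It is known in kernel with `C₀ = Ī`, the
average total influence of the trees (`ClassicalCornerSensitivityOSSS.sixteen_variance_sq_le_avgSensitivity_mul`), via
the per-tree BILINEAR OSSS inequality `Cov[F,g] ≤ ¼·√(I[F])·√(Σⱼ δⱼ(t)·Infⱼ[g])` (`osss_sens`) and Cauchy–Schwarz over
the mixture (`Var[p] = Σ_k w_k Cov([t_k accepts], p)`).  The same averaging would give an ABSOLUTE `C₀ = 4A` from any
per-tree inequality of the shape

  `(⋆)  Cov[F, g]² ≤ A · Var[F] · Σⱼ δⱼ(t) · Infⱼ[g]`   (`F` the `0/1` output of a tree `t`, `g` arbitrary, `A` absolute),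

i.e. `osss_sens` with the tree's total influence `I[F] ≤ depth` replaced by (a multiple of) its variance `Var[F] ≤ ¼`
(by convex duality `(⋆)` is the "linear relaxation" of the hands' numerics: `sup_g Cov[F,g]²/(Var F·Σⱼδⱼ Infⱼ[g])
= Σ_S F̂(S)²/(4δ_t(S)) / Var F`, the `F̂²`-weighted HARMONIC mean of the query weights `δ_t(S) = Σ_{j∈S} δⱼ(t)`, where
OSSS itself bounds the ARITHMETIC mean `Σ_S F̂(S)² δ_t(S) ≥ ¼·Var F`).

This file proves that `(⋆)` is FALSE for every `A`: for the CATERPILLAR tree `t_N` on `N` bits (read `x₀, x₁, …` in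
order, reject at the first `0`, accept `1^N`; `F = AND_N`, `Var[F] ≈ 2^{-N}`, `δⱼ = 2^{-j}`) and the TERMINAL-RUN LENGTH
`g(x) = #{m : x_m = … = x_{N-1} = 1}` (read from the OTHER end),

  `Cov[F,g] ≥ (N−1)·2^{-N}`,  `Var[F] ≤ 2^{-N}`,  `Σⱼ δⱼ(t_N)·Infⱼ[g] ≤ 12·N·2^{-N}`,

so `Cov²/(Var F · Σⱼ δⱼ Infⱼ[g]) ≥ (N−1)²/(12N) → ∞` (`caterpillar_ratio`, un-normalised cube sums exactly as in
`osss_sens`; `exists_varNormalised_bilinear_osss_violation`: `∀ A, ∃ N t g, A·Var·Σδ Inf < Cov²`).  Exact enumeration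
(hands' scratch, `N ≤ 10`) gives the ratio `≈ 0.088·N`; the hands' optimised numerics for the same tree reported
`≈ 0.34·depth + 0.65`.  Reading: an absolute-constant `L²`-OSSS law on `R_T`, if true, cannot be proved tree by tree
with the variance normalisation — the mixture structure (`g = p` is itself the average of the trees) must be used; and
the OSSS inequality admits no harmonic-mean strengthening `Σ_S F̂(S)²/δ_t(S) ≤ O(1)·Var F`.

Contents (part 2/2; the caterpillar tree `exists_caterpillar`, its query weights `card_queries_caterpillar_le`, and the
terminal-run length's squared increments `sum_sq_increment_runLength_le` are in part 1,
`…ClassicalCornerL2OSSSNoGoPrep.lean`): **`caterpillar_ratio`** (the quantitative family) and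
**`exists_varNormalised_bilinear_osss_violation`** (`∀ A, ∃ N t g, A·Var·Σδ Inf < Cov²`).

Honest label: calibration (a no-go for one proof strategy) inside the classical corner of an open conjecture; no
registered stub, crux or summit is closed.  Sources: R. O'Donnell, M. Saks, O. Schramm, R. Servedio, *Every decision
tree has an influential variable*, FOCS 2005, Thm 3.2; R. O'Donnell, *Analysis of Boolean Functions* (2014) §8.6;
S. Aaronson, A. Ambainis, arXiv:0911.0996, Thm 8 and the remark following it.
-/

set_option linter.dupNamespace false

noncomputable section

namespace Summit.QuantumAdvantage.QuantumAdvantage.Theorems.SosSandwich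

open Finset Function
open Literature.Computability.Complexity

namespace ClassicalCornerL2OSSSNoGo

variable {N : ℕ}

/-! ### The ratio -/

/-- **The caterpillar ratio.** For every `N ≥ 1` there are a depth-`N` decision tree `t` on `N` bits (the
caterpillar, `F = [t accepts] = AND_N`) and a real function `g` on the cube (the terminal-run length) with, in the
un-normalised cube sums of `osss_sens`,
`(N−1)² · (2^N Σ F² − (Σ F)²) · Σⱼ #{x : j ∈ t.queries x}·Σₓ (g(x^{j→1}) − g(x^{j→0}))² ≤ 12N · (2^N Σ F g − Σ F Σ g)²`,
i.e. `Cov[F,g]² ≥ ((N−1)²/(12N)) · Var[F] · Σⱼ δⱼ(t) Infⱼ[g]`. [folklore] -/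
theorem caterpillar_ratio (N : ℕ) (hN : 1 ≤ N) :
    ∃ (t : DecisionTree N) (g F : (Fin N → Bool) → ℝ), t.depth = N ∧
      (∀ x, F x = if t.eval x = true then (1 : ℝ) else 0) ∧
      0 < (2 : ℝ) ^ N * (∑ x, F x * g x) - (∑ x, F x) * (∑ x, g x) ∧
      ((N : ℝ) - 1) ^ 2 * (((2 : ℝ) ^ N * (∑ x, F x ^ 2) - (∑ x, F x) ^ 2) *
          ∑ j, ((Finset.univ.filter fun x : Fin N → Bool => j ∈ t.queries x).card : ℝ) *
            ∑ x, (g (update x j true) - g (update x j false)) ^ 2)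
        ≤ 12 * N * ((2 : ℝ) ^ N * (∑ x, F x * g x) - (∑ x, F x) * (∑ x, g x)) ^ 2 := by
  classical
  obtain ⟨t, hd, hev, hq⟩ := exists_caterpillar N
  set g : (Fin N → Bool) → ℝ := fun x => ∑ m : Fin N, (if ∀ i, m ≤ i → x i = true then (1 : ℝ) else 0) with hgdef
  set F : (Fin N → Bool) → ℝ := fun x => if ∀ i, x i = true then (1 : ℝ) else 0 with hFdef
  have hF : ∀ x, F x = if t.eval x = true then (1 : ℝ) else 0 := fun x => by simp only [hFdef, hev x]
  refine ⟨t, g, F, hd, hF, ?_⟩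
  -- the `F`-side sums
  have hF1 : ∑ x, F x = 1 := sum_ite_forall_eq_one
  have hF2 : ∑ x, F x ^ 2 = 1 := by
    rw [← hF1]
    refine Finset.sum_congr rfl fun x _ => ?_
    simp only [hFdef]
    split_ifs <;> norm_num
  have hFg : ∑ x, F x * g x = N := by
    have hpt : ∀ x, F x * g x = F x * N := by
      intro x
      by_cases hx : ∀ i, x i = true
      · have hgx : g x = N := by
          simp only [hgdef]
          rw [Finset.sum_congr rfl fun m _ => if_pos (fun i _ => hx i)]
          simp
        rw [hgx]
      · simp only [hFdef, if_neg hx, zero_mul]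
    rw [Finset.sum_congr rfl fun x _ => hpt x, ← Finset.sum_mul, hF1, one_mul]
  have hgsum : ∑ x, g x ≤ (2 : ℝ) ^ N := by
    simp only [hgdef]
    rw [Finset.sum_comm]
    have hm : ∀ m : Fin N, ∑ x : Fin N → Bool, (if ∀ i, m ≤ i → x i = true then (1 : ℝ) else 0)
        = (2 : ℝ) ^ (m : ℕ) := by
      intro m
      have hre : ∀ x : Fin N → Bool, (if ∀ i, m ≤ i → x i = true then (1 : ℝ) else 0) =
          if ∀ i ∈ Finset.Ici m, x i = true then (1 : ℝ) else 0 := by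
        intro x
        have : (∀ i, m ≤ i → x i = true) ↔ ∀ i ∈ Finset.Ici m, x i = true :=
          ⟨fun h i hi => h i (Finset.mem_Ici.mp hi), fun h i hi => h i (Finset.mem_Ici.mpr hi)⟩
        simp only [this]
      rw [Finset.sum_congr rfl fun x _ => hre x, sum_ite_forall_mem, Fin.card_Ici]
      congr 1
      have := m.isLt
      omega
    rw [Finset.sum_congr rfl fun m _ => hm m, Fin.sum_univ_eq_sum_range (fun m => (2 : ℝ) ^ m),
      geom_sum_eq (by norm_num : (2 : ℝ) ≠ 1)]
    norm_num
  -- the covariance is at least `2^N (N-1)`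
  have hN1 : (1 : ℝ) ≤ N := by exact_mod_cast hN
  have h2N : (0 : ℝ) < (2 : ℝ) ^ N := by positivity
  have hcov : (2 : ℝ) ^ N * ((N : ℝ) - 1) ≤ (2 : ℝ) ^ N * (∑ x, F x * g x) - (∑ x, F x) * (∑ x, g x) := by
    rw [hFg, hF1, one_mul]
    nlinarith
  have hcov0 : 0 ≤ (2 : ℝ) ^ N * ((N : ℝ) - 1) := mul_nonneg h2N.le (by linarith)
  refine ⟨?_, ?_⟩
  · -- positivity of the covariance: `2^N·N − Σ g ≥ 2^N N − 2^N + … > 0`; use `Σ g ≤ 2^N` and `N ≥ 1` with `2^N N - Σg`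
    rw [hFg, hF1, one_mul]
    -- `Σ g ≤ 2^N ≤ 2^N · N`, strictness from `Σ_x g x ≤ 2^N - 1` is not available; use `2^N N ≥ 2^N` and `Σ g < 2^N N`?
    -- we show `Σ g < 2^N · N` via `Σ g ≤ 2^N` and, if `N = 1`, directly.
    rcases Nat.lt_or_ge 1 N with hlt | hle
    · have : (2 : ℝ) ≤ N := by exact_mod_cast hlt
      nlinarith
    · have hN' : N = 1 := le_antisymm hle hN
      subst hN'
      -- `N = 1`: `Σ_x g x = 1 < 2`
      have hg1 : ∑ x : Fin 1 → Bool, g x = 1 := by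
        simp only [hgdef]
        rw [Finset.sum_comm]
        simp only [Finset.univ_unique, Fin.default_eq_zero, Finset.sum_singleton, Fin.isValue]
        have : ∀ x : Fin 1 → Bool, (if ∀ i : Fin 1, (0 : Fin 1) ≤ i → x i = true then (1 : ℝ) else 0) =
            if ∀ i ∈ (Finset.univ : Finset (Fin 1)), x i = true then (1 : ℝ) else 0 := by
          intro x
          have : (∀ i : Fin 1, (0 : Fin 1) ≤ i → x i = true) ↔ ∀ i ∈ (Finset.univ : Finset (Fin 1)), x i = true :=
            ⟨fun h i _ => h i (Fin.zero_le _), fun h i _ => h i (Finset.mem_univ _)⟩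
          simp only [this]
        rw [Finset.sum_congr rfl fun x _ => this x, sum_ite_forall_mem]
        simp
      rw [hg1]
      norm_num
  · -- the main inequality
    have hV : (2 : ℝ) ^ N * (∑ x, F x ^ 2) - (∑ x, F x) ^ 2 ≤ (2 : ℝ) ^ N := by
      rw [hF2, hF1]; nlinarith
    have hV0 : 0 ≤ (2 : ℝ) ^ N * (∑ x, F x ^ 2) - (∑ x, F x) ^ 2 := by
      rw [hF2, hF1]
      have : (1 : ℝ) ≤ 2 ^ N := one_le_pow₀ (by norm_num)
      linarith
    have hWS : ∑ j, ((Finset.univ.filter fun x : Fin N → Bool => j ∈ t.queries x).card : ℝ) *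
        ∑ x, (g (update x j true) - g (update x j false)) ^ 2 ≤ 12 * N * (2 : ℝ) ^ N := by
      have hterm : ∀ j : Fin N, ((Finset.univ.filter fun x : Fin N → Bool => j ∈ t.queries x).card : ℝ) *
          ∑ x, (g (update x j true) - g (update x j false)) ^ 2 ≤ 12 * (2 : ℝ) ^ N := by
        intro j
        have hW := card_queries_caterpillar_le t hq j
        have hS := sum_sq_increment_runLength_le g (fun x => rfl) j
        have hW0 : (0 : ℝ) ≤ ((Finset.univ.filter fun x : Fin N → Bool => j ∈ t.queries x).card : ℝ) :=
          Nat.cast_nonneg _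
        have hS0 : (0 : ℝ) ≤ ∑ x, (g (update x j true) - g (update x j false)) ^ 2 :=
          Finset.sum_nonneg fun x _ => sq_nonneg _
        calc ((Finset.univ.filter fun x : Fin N → Bool => j ∈ t.queries x).card : ℝ) *
              ∑ x, (g (update x j true) - g (update x j false)) ^ 2
            ≤ (2 : ℝ) ^ (N - (j : ℕ)) * (12 * (2 : ℝ) ^ (j : ℕ)) :=
              mul_le_mul hW hS hS0 (by positivity)
          _ = 12 * (2 : ℝ) ^ N := by
              have hj : (j : ℕ) ≤ N := j.isLt.le
              rw [show (12 : ℝ) * 2 ^ N = 12 * (2 ^ (N - (j : ℕ)) * 2 ^ (j : ℕ)) by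
                rw [← pow_add, Nat.sub_add_cancel hj]]
              ring
      calc ∑ j, ((Finset.univ.filter fun x : Fin N → Bool => j ∈ t.queries x).card : ℝ) *
            ∑ x, (g (update x j true) - g (update x j false)) ^ 2
          ≤ ∑ _j : Fin N, 12 * (2 : ℝ) ^ N := Finset.sum_le_sum fun j _ => hterm j
        _ = 12 * N * (2 : ℝ) ^ N := by
            rw [Finset.sum_const, Finset.card_univ, Fintype.card_fin, nsmul_eq_mul]; ring
    have hWS0 : 0 ≤ ∑ j, ((Finset.univ.filter fun x : Fin N → Bool => j ∈ t.queries x).card : ℝ) *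
        ∑ x, (g (update x j true) - g (update x j false)) ^ 2 :=
      Finset.sum_nonneg fun j _ => mul_nonneg (Nat.cast_nonneg _) (Finset.sum_nonneg fun x _ => sq_nonneg _)
    -- `(N-1)² · V · WS ≤ (N-1)² · 2^N · 12 N 2^N = 12 N (2^N (N-1))² ≤ 12 N Cov²`
    have hsq : ((2 : ℝ) ^ N * ((N : ℝ) - 1)) ^ 2 ≤
        ((2 : ℝ) ^ N * (∑ x, F x * g x) - (∑ x, F x) * (∑ x, g x)) ^ 2 :=
      pow_le_pow_left₀ hcov0 hcov 2
    have hN0 : (0 : ℝ) ≤ N := Nat.cast_nonneg _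
    calc ((N : ℝ) - 1) ^ 2 * (((2 : ℝ) ^ N * (∑ x, F x ^ 2) - (∑ x, F x) ^ 2) *
          ∑ j, ((Finset.univ.filter fun x : Fin N → Bool => j ∈ t.queries x).card : ℝ) *
            ∑ x, (g (update x j true) - g (update x j false)) ^ 2)
        ≤ ((N : ℝ) - 1) ^ 2 * ((2 : ℝ) ^ N * (12 * N * (2 : ℝ) ^ N)) :=
          mul_le_mul_of_nonneg_left (mul_le_mul hV hWS hWS0 h2N.le) (sq_nonneg _)
      _ = 12 * N * ((2 : ℝ) ^ N * ((N : ℝ) - 1)) ^ 2 := by ring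
      _ ≤ 12 * N * ((2 : ℝ) ^ N * (∑ x, F x * g x) - (∑ x, F x) * (∑ x, g x)) ^ 2 :=
          mul_le_mul_of_nonneg_left hsq (by positivity)

/-- **No variance-normalised bilinear OSSS inequality.** For every real `A` there are `N`, a decision tree `t` on
`N` bits with `0/1` output `F`, and a real function `g` on the cube such that
`A · (2^N Σ F² − (Σ F)²) · Σⱼ #{x : j ∈ t.queries x}·Σₓ (g(x^{j→1}) − g(x^{j→0}))² < (2^N Σ F·g − Σ F·Σ g)²`,
i.e. `Cov[F,g]² > A · Var[F] · Σⱼ δⱼ(t)·Infⱼ[g]`: the bilinear OSSS inequality `osss_sens`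
(`Cov ≤ ¼√(I[F])√(Σⱼ δⱼ Infⱼ[g])`) admits no version with the total influence `I[F]` replaced by a constant multiple
of `Var[F]`, and the per-tree route to an absolute-constant `L²`-OSSS law on mixtures is closed. [folklore] -/
theorem exists_varNormalised_bilinear_osss_violation (A : ℝ) :
    ∃ (N : ℕ) (t : DecisionTree N) (g F : (Fin N → Bool) → ℝ),
      (∀ x, F x = if t.eval x = true then (1 : ℝ) else 0) ∧
      A * ((((2 : ℝ) ^ N * (∑ x, F x ^ 2) - (∑ x, F x) ^ 2)) *
          ∑ j, ((Finset.univ.filter fun x : Fin N → Bool => j ∈ t.queries x).card : ℝ) *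
            ∑ x, (g (update x j true) - g (update x j false)) ^ 2)
        < ((2 : ℝ) ^ N * (∑ x, F x * g x) - (∑ x, F x) * (∑ x, g x)) ^ 2 := by
  classical
  -- choose `N` with `12 N A < (N-1)²`
  set N : ℕ := ⌈12 * A⌉₊ + 3 with hNdef
  have hN : 1 ≤ N := by omega
  obtain ⟨t, g, F, -, hF, hpos, hmain⟩ := caterpillar_ratio N hN
  refine ⟨N, t, g, F, hF, ?_⟩
  set X := (((2 : ℝ) ^ N * (∑ x, F x ^ 2) - (∑ x, F x) ^ 2)) *
      ∑ j, ((Finset.univ.filter fun x : Fin N → Bool => j ∈ t.queries x).card : ℝ) *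
        ∑ x, (g (update x j true) - g (update x j false)) ^ 2 with hX
  set Cv := (2 : ℝ) ^ N * (∑ x, F x * g x) - (∑ x, F x) * (∑ x, g x) with hCv
  have hCv2 : 0 < Cv ^ 2 := by positivity
  by_cases hA : A ≤ 0
  · -- `X ≥ 0` would be needed for `A·X ≤ 0`; instead argue: if `X ≥ 0` done, if `X < 0` then … `X ≥ 0` always:
    have hX0 : 0 ≤ X := by
      have h1 : 0 ≤ (2 : ℝ) ^ N * (∑ x, F x ^ 2) - (∑ x, F x) ^ 2 := by
        -- Cauchy–Schwarz: `(Σ F)² ≤ #cube · Σ F²`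
        have hcs : (∑ x : Fin N → Bool, F x * 1) ^ 2 ≤ (∑ x : Fin N → Bool, F x ^ 2) * ∑ _x : Fin N → Bool, (1 : ℝ) ^ 2 :=
          Finset.sum_mul_sq_le_sq_mul_sq _ _ _
        simp only [mul_one, one_pow, Finset.sum_const, Finset.card_univ, Fintype.card_fun, Fintype.card_bool,
          Fintype.card_fin, nsmul_eq_mul] at hcs
        push_cast at hcs
        linarith
      exact mul_nonneg h1 (Finset.sum_nonneg fun j _ =>
        mul_nonneg (Nat.cast_nonneg _) (Finset.sum_nonneg fun x _ => sq_nonneg _))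
    calc A * X ≤ 0 := mul_nonpos_of_nonpos_of_nonneg hA hX0
      _ < Cv ^ 2 := hCv2
  · push Not at hA
    have hceil : 12 * A ≤ (⌈12 * A⌉₊ : ℝ) := Nat.le_ceil _
    have hNR : (N : ℝ) = (⌈12 * A⌉₊ : ℝ) + 3 := by rw [hNdef]; push_cast; ring
    have hkey : 12 * (N : ℝ) * A < ((N : ℝ) - 1) ^ 2 := by
      rw [hNR]
      nlinarith
    -- from `hmain : (N-1)² X ≤ 12 N Cv²`
    have hN0 : (0 : ℝ) < N := by rw [hNR]; positivity
    by_contra hcon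
    push Not at hcon
    -- `Cv² ≤ A X`, so `(N-1)² Cv² ≤ (N-1)² A X = A (N-1)² X ≤ A · 12 N Cv² < (N-1)² Cv²`
    have h1 : ((N : ℝ) - 1) ^ 2 * Cv ^ 2 ≤ A * (12 * N * Cv ^ 2) := by
      calc ((N : ℝ) - 1) ^ 2 * Cv ^ 2 ≤ ((N : ℝ) - 1) ^ 2 * (A * X) :=
            mul_le_mul_of_nonneg_left hcon (sq_nonneg _)
        _ = A * (((N : ℝ) - 1) ^ 2 * X) := by ring
        _ ≤ A * (12 * N * Cv ^ 2) := mul_le_mul_of_nonneg_left hmain hA.le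
    nlinarith

/-- **No-go, negation form.** There is NO constant `A` such that for all decision trees `t` (with `0/1` output `F`)
and all real `g` on the cube, `(2^N Σ F·g − Σ F·Σ g)² ≤ A·(2^N Σ F² − (Σ F)²)·Σⱼ #{x : j ∈ t.queries x}·Σₓ (g(x^{j→1}) − g(x^{j→0}))²`
(`Cov[F,g]² ≤ A·Var[F]·Σⱼ δⱼ(t) Infⱼ[g]`).  Consequently an absolute-constant `L²`-OSSS law for mixtures of trees, if
true, cannot follow from a per-tree inequality with the variance normalisation by Cauchy–Schwarz over the mixture (the
route that yields `C₀ = Ī` from `osss_sens`). [folklore] -/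
theorem not_exists_varNormalised_bilinear_osss :
    ¬ ∃ A : ℝ, ∀ (N : ℕ) (t : DecisionTree N) (g F : (Fin N → Bool) → ℝ),
      (∀ x, F x = if t.eval x = true then (1 : ℝ) else 0) →
      ((2 : ℝ) ^ N * (∑ x, F x * g x) - (∑ x, F x) * (∑ x, g x)) ^ 2 ≤
        A * ((((2 : ℝ) ^ N * (∑ x, F x ^ 2) - (∑ x, F x) ^ 2)) *
          ∑ j, ((Finset.univ.filter fun x : Fin N → Bool => j ∈ t.queries x).card : ℝ) *
            ∑ x, (g (update x j true) - g (update x j false)) ^ 2) := by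
  rintro ⟨A, hA⟩
  obtain ⟨N, t, g, F, hF, hlt⟩ := exists_varNormalised_bilinear_osss_violation A
  exact absurd (hA N t g F hF) (not_le.mpr hlt)

end ClassicalCornerL2OSSSNoGo

end Summit.QuantumAdvantage.QuantumAdvantage.Theorems.SosSandwich

end
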